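import Summits.ABC.IUTFork.Joshi.BundlingRings
import Summits.ABC.IUTFork.Joshi.TensorNorms

/-!
# Joshi's Thm. 7.7.3.1 at one prime, COMPOSED across the typed §7.6 (E-t14) and §7.5/§7.7 (E-t13) files:
# from the cross-norm claim Thm. 7.6.2.2 (E-t14's `TensorNorm.HasCrossNorm` / `CrossNormClaimQp`) to E-t13's `CrossNormAt`

Block E of the abc-iut cell (rung LADDER-ABC:A2.E; seat abc-iut-E-t13, slot T-13; merge-debt «§7.6 tensor norms = E-t14» of
`Joshi/BundlingRings.lean`, p429549). K. Joshi, *Construction of Arithmetic Teichmüller Spaces III*, arXiv:2401.13508v4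
(UNREFEREED, disputed; `Joshi2024ATS3`): the proof of Thm. 7.7.3.1 (p. 66 l. 104 – p. 67 l. 47) invokes (7.7.3.2) «the
properties of tensor products `⊗_{w|p} B_{E′_w}` established in Lemma 7.6.4.1, Lemma 7.6.5.1» = the cross-norm property, which
E-t14 typed as `Summit.ABC.IUTFork.Joshi.TensorNorm.HasCrossNorm` over Mathlib's `PiTensorProduct` (with Thm. 7.6.2.2 (3)/(4) as
the claims `CrossNormClaim` / `CrossNormClaimQp`), and which `BundlingRings` consumes abstractly as `PrimeBundlingDatum.CrossNormAt`.

THIS FILE (glue, all PROVED; nothing asserted): (1) `PrimeBundlingDatum.ofNormed` — the §7.5/§7.7 datum whose tensor ring IS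
Mathlib's `⨂[𝕜] w ∈ 𝕍^{odd,ss}_p, B_{E′_w}` (Joshi's literal (7.7.1.1), uncompleted as in print) with the pure-tensor monoid
homomorphism `PiTensorProduct.tprodMonoidHom` (§7.7.2), the factor norms the given Banach norms `‖·‖` on the `B_{E′_w}` and the
tensor norm a given real function `N ρ`; (2) `crossNormAt_ofNormed` — E-t14's `HasCrossNorm (N ρ)` IS E-t13's `CrossNormAt ρ`
for that datum; (3) `localFundamentalEstimate_ofNormed` — hence Thm. 7.7.3.1 at `p` for that datum from `HasCrossNorm` + the
per-`w` pilot lower bound; (4) over `𝕜 = ℚ_p` with the projective norm: `localFundamentalEstimate_of_crossNormClaimQp` — Joshi's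
Thm. 7.6.2.2 (4) (`CrossNormClaimQp p`, a typed CLAIM of E-t14's file, hypothesis here) + completeness of the `B_{E′_w}` + the
pilot lower bound ⟹ Thm. 7.7.3.1 at `p`. So the only undischarged inputs of Joshi's Thm. 7.7.3.1 in kernel are exactly the two
he cites: [Joshi 2023b] Thm. 9.2.1 (per `w`) and [Schneider 2002, Prop. 17.4] as he states it (Thm. 7.6.2.2 (3)/(4)).

HONEST LIMITS (for the referee lanes): ONE norm per factor — Mathlib's `‖·‖` on `B_{E′_w}` stands for Joshi's `|−|_{B_{E′_w};ρ}`
at a FIXED `ρ` (his Fréchet family would need one normed copy of `B_E` per `ρ`; the derivation of Thm. 7.7.3.1 uses one `ρ`),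
so `nrm w ρ := ‖·‖` is `ρ`-independent here; `CrossNormClaimQp` asks COMPLETE spaces (E-t14's faithfulness note: the `B_E` with
one Fréchet norm are normed, not complete — his `CrossNormSeminormedClaim` variant drops completeness). No side taken on
[IUTchIII] Cor. 3.12, on Joshi's claims or on Mochizuki's reports; typed ≠ proved ≠ endorsed. Standard axioms; sorry-free.
-/

noncomputable section

open scoped TensorProduct

namespace Summit.ABC.IUTFork.Joshi.ATS3

namespace PrimeBundlingDatum

section Normed

variable {lstar : ℕ} {𝕜 Bp : Type} [NontriviallyNormedField 𝕜] [CommRing Bp] [Algebra 𝕜 Bp] {I : Type} [Fintype I]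
  [DecidableEq I] {E BE : I → Type} [∀ w, Field (E w)] [∀ w, Algebra 𝕜 (E w)] [∀ w, NormedCommRing (BE w)]
  [∀ w, NormedAlgebra 𝕜 (BE w)] [∀ w, Algebra Bp (BE w)]

/-- **The §7.5/§7.7 datum over NORMED factors with Joshi's literal tensor ring** (7.7.1.1) `B̆⊗_{L′,p} := ⨂[𝕜] w ∈ 𝕍^{odd,ss}_p,
B_{E′_w}` (Mathlib `PiTensorProduct`, uncompleted as in print, p. 65 l. 36–37), the §7.7.2 «homomorphism (given by the
construction of tensor products)» = `PiTensorProduct.tprodMonoidHom`, factor norms `|−|_{B_{E′_w};ρ} := ‖·‖` (one Banach norm per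
factor, `ρ`-independent — HONEST LIMITS) and tensor norms a given family `N ρ` of non-negative real functions (e.g. the
projective norm, `ofProjective`). The remaining fields (index sets, comparison maps, INPUT loci, `|q_w^{1/2ℓ}|`) are passed
through. [claim: Joshi2024ATS3, status: disputed] -/
def ofNormed (Vp Vss : Finset I) (hV : Vss ⊆ Vp) (toTensE : (w : I) → BE w →ₗ[𝕜] Bp ⊗[𝕜] E w)
    (locusBE : (w : I) → Set (Fin lstar → BE w)) (N : ℝ → (⨂[𝕜] w : Vss, BE w.1) → ℝ) (hN : ∀ ρ t, 0 ≤ N ρ t)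
    (qRoot : I → ℝ) (hq : ∀ w ∈ Vss, 0 < qRoot w) :
    PrimeBundlingDatum lstar 𝕜 Bp I E BE (⨂[𝕜] w : Vss, BE w.1) where
  Vp := Vp
  Vss := Vss
  Vss_subset := hV
  nrm := fun _ _ x => ‖x‖
  nrm_nonneg := fun _ _ x => norm_nonneg x
  toTensE := toTensE
  locusBE := locusBE
  tprod := PiTensorProduct.tprodMonoidHom 𝕜
  normT := N
  normT_nonneg := hN
  qRoot := qRoot
  qRoot_pos := hq

variable (Vp Vss : Finset I) (hV : Vss ⊆ Vp) (toTensE : (w : I) → BE w →ₗ[𝕜] Bp ⊗[𝕜] E w)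
  (locusBE : (w : I) → Set (Fin lstar → BE w)) (N : ℝ → (⨂[𝕜] w : Vss, BE w.1) → ℝ) (hN : ∀ ρ t, 0 ≤ N ρ t)
  (qRoot : I → ℝ) (hq : ∀ w ∈ Vss, 0 < qRoot w)

/-- **E-t14's cross-norm property IS E-t13's `CrossNormAt`** for the literal datum: if the tensor norm `N ρ` has Joshi's
cross-norm property (7.6.2.1) in E-t14's typing (`TensorNorm.HasCrossNorm`: `N ρ (⊗ₜ m) = ∏ ‖m_w‖`), then (7.7.3.2) holds for
`ofNormed` at `ρ`. PROVED (definitional unfolding). [folklore] -/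
theorem crossNormAt_ofNormed {ρ : ℝ} (hx : TensorNorm.HasCrossNorm (N ρ)) :
    (ofNormed Vp Vss hV toTensE locusBE N hN qRoot hq).CrossNormAt ρ :=
  fun x => hx x

/-- **Thm. 7.7.3.1 at `p` for the literal datum, from E-t14's cross-norm property and the per-`w` pilot lower bound**
([Joshi 2023b] Thm. 9.2.1; (7.7.3.3)) at one `ρ ∈ (0,1]` — the composition `HasCrossNorm ⟹ CrossNormAt ⟹ (BundlingRings)
LocalFundamentalEstimate`. PROVED; the two inputs stay hypotheses. [folklore] -/
theorem localFundamentalEstimate_ofNormed {ρ : ℝ} (hρ : ρ ∈ Set.Ioc (0 : ℝ) 1) (hx : TensorNorm.HasCrossNorm (N ρ))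
    (hZ : (ofNormed Vp Vss hV toTensE locusBE N hN qRoot hq).PilotLowerBoundAt ρ) :
    (ofNormed Vp Vss hV toTensE locusBE N hN qRoot hq).LocalFundamentalEstimate :=
  (ofNormed Vp Vss hV toTensE locusBE N hN qRoot hq).localFundamentalEstimate_of_pilot_of_crossNorm hρ hZ
    (crossNormAt_ofNormed Vp Vss hV toTensE locusBE N hN qRoot hq hx)

/-- The literal datum with the PROJECTIVE tensor norm (Mathlib's norm instance on `⨂[𝕜]`, J3 p. 61 l. 26–30) at every `ρ`.
[claim: Joshi2024ATS3, status: disputed] -/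
def ofProjective : PrimeBundlingDatum lstar 𝕜 Bp I E BE (⨂[𝕜] w : Vss, BE w.1) :=
  ofNormed Vp Vss hV toTensE locusBE (fun _ t => ‖t‖) (fun _ t => norm_nonneg t) qRoot hq

/-- For the projective datum, (7.7.3.2) at any `ρ` is exactly E-t14's `HasCrossNorm ‖·‖` (Lemma 7.6.6.1 (7.6.6.2) form).
PROVED. [folklore] -/
theorem crossNormAt_ofProjective (hx : TensorNorm.HasCrossNorm fun t : ⨂[𝕜] w : Vss, BE w.1 => ‖t‖) (ρ : ℝ) :
    (ofProjective Vp Vss hV toTensE locusBE qRoot hq).CrossNormAt ρ :=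
  fun x => hx x

end Normed

section Padic

variable {lstar : ℕ} {p : ℕ} [Fact p.Prime] {Bp : Type} [CommRing Bp] [Algebra ℚ_[p] Bp] {I : Type} [Fintype I]
  [DecidableEq I] {E BE : I → Type} [∀ w, Field (E w)] [∀ w, Algebra ℚ_[p] (E w)] [∀ w, NormedCommRing (BE w)]
  [∀ w, NormedAlgebra ℚ_[p] (BE w)] [∀ w, Algebra Bp (BE w)]
  (Vp Vss : Finset I) (hV : Vss ⊆ Vp) (toTensE : (w : I) → BE w →ₗ[ℚ_[p]] Bp ⊗[ℚ_[p]] E w)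
  (locusBE : (w : I) → Set (Fin lstar → BE w)) (qRoot : I → ℝ) (hq : ∀ w ∈ Vss, 0 < qRoot w)

/-- **Joshi's Thm. 7.6.2.2 (4) ⟹ (7.7.3.2)**: under E-t14's typed CLAIM `CrossNormClaimQp p` («for `E = ℚ_p` one has
`|v ⊗ w| = |v|·|w|`», J3 p. 62 l. 13–14; [Schneider 2002, Prop. 17.4]) and completeness of the factors `B_{E′_w}`, the projective
datum over `ℚ_p` has the cross-norm property at every `ρ`. PROVED from E-t14's `TensorNorm.norm_tprod_of_crossNormClaimQp`;
the claim itself stays a hypothesis. [folklore] -/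
theorem crossNormAt_of_crossNormClaimQp (h : TensorNorm.CrossNormClaimQp.{0, 0} p) (hc : ∀ w : Vss, CompleteSpace (BE w.1))
    (ρ : ℝ) : (ofProjective Vp Vss hV toTensE locusBE qRoot hq).CrossNormAt ρ :=
  crossNormAt_ofProjective Vp Vss hV toTensE locusBE qRoot hq
    (fun m => TensorNorm.norm_tprod_of_crossNormClaimQp h (fun w : Vss => BE w.1) hc m) ρ

/-- **Thm. 7.7.3.1 at `p`, end to end in kernel modulo exactly the two inputs Joshi cites**: E-t14's typed claim
`CrossNormClaimQp p` (Thm. 7.6.2.2 (4) = [Schneider 2002, Prop. 17.4] as stated by Joshi) + completeness of the `B_{E′_w}` +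
the per-`w` pilot lower bound at some `ρ ∈ (0,1]` ([Joshi 2023b] Thm. 9.2.1; (7.7.3.3)) ⟹ `|Θ̃^{B̆⊗}_{Joshi,p}|_{B̆⊗} ≥
∏_{w ∈ 𝕍^{odd,ss}_p} |q_w^{1/2ℓ}|^{ℓ⋇}` for the literal projective-norm datum. PROVED composition; inputs remain hypotheses;
typed ≠ proved ≠ endorsed. [folklore] -/
theorem localFundamentalEstimate_of_crossNormClaimQp (h : TensorNorm.CrossNormClaimQp.{0, 0} p)
    (hc : ∀ w : Vss, CompleteSpace (BE w.1)) {ρ : ℝ} (hρ : ρ ∈ Set.Ioc (0 : ℝ) 1)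
    (hZ : (ofProjective Vp Vss hV toTensE locusBE qRoot hq).PilotLowerBoundAt ρ) :
    (ofProjective Vp Vss hV toTensE locusBE qRoot hq).LocalFundamentalEstimate :=
  (ofProjective Vp Vss hV toTensE locusBE qRoot hq).localFundamentalEstimate_of_pilot_of_crossNorm hρ hZ
    (crossNormAt_of_crossNormClaimQp Vp Vss hV toTensE locusBE qRoot hq h hc ρ)

end Padic

end PrimeBundlingDatum

end Summit.ABC.IUTFork.Joshi.ATS3

end
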